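import Mathlib.RingTheory.MvPolynomial.Basic
import Mathlib.Algebra.MvPolynomial.Monad
import Mathlib.LinearAlgebra.Matrix.Basis
import Mathlib.LinearAlgebra.Matrix.ToLin
import Mathlib.LinearAlgebra.FreeModule.Finite.Basic
import Mathlib.LinearAlgebra.TensorProduct.Tower
import Mathlib.Topology.Algebra.OpenSubgroup
import Mathlib.RingTheory.EssentialFiniteness
import Mathlib.NumberTheory.NumberField.Basic
import Literature.AlgebraicGeometry.Motives.EtaleRealization
import Literature.AlgebraicGeometry.Motives.HodgeTensor
import Literature.AlgebraicGeometry.Motives.AbelianVariety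
import Literature.AlgebraicGeometry.Motives.AbstractHodgeTate
import HarnessLib

-- provenance: harness21/H21/H21/Statements/Hodge/EtaleTate.lean @ c94f1ec (interim HEAD d8f2665); M5 mechanical rewrite
/-!
# ℓ-adic cohomology as a Galois representation; Tate ⇒ Hodge for abelian varieties;
# the Mumford–Tate conjecture (family Hodge, trunk MotiveL, outline §3)

This statements file records three inventory items against the accepted hypothesis structures
`Literature.EtaleRealization k ℓ` (ℓ-adic étale cohomology with its continuous Galois action, prelude
C5), `Literature.BettiHodgeData ℂ` (Betti cohomology with its Hodge structures, G17) and
`Literature.ArtinComparison E B σ` (Artin's comparison isomorphism `H_B ⊗ ℚ_ℓ ≅ H_ét`, C5):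

* **hodge.S26** (SGA 4½ [Cycle]; Tate, PSPM 55 (1994) §1; Milne, *Étale cohomology* VI.9):
  the *definitions* of `Hⁱ(X_{k̄}, ℚ_ℓ(j))` as a continuous Galois representation, of the Tate
  twist, of the Tate classes and of the ℓ-adic cycle class map — all accepted in the prelude
  (`EtaleRealization.galoisRep`, `.galoisRepTwist`, `GaloisWeilCohomology.tateClasses`,
  `WeilCohomology.chowGroupCycleMap`); here we state their defining/characteristic properties:
  `galoisRep_apply'`, `galoisRepTwist_apply'`, `tateClasses_def`,
  `chowGroupCycleMap_mem_invariants_twist'` (the cycle class map `CH_d(X) → H²ᵖ(X)(p)` is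
  `Γ_k`-equivariant, real proof) and `isProetaleModel_iff` (pin to Mathlib's
  `Scheme.EllAdicCohomology`).
* **hodge.S20** (Piatetski-Shapiro 1971; Deligne, *Hodge cycles on abelian varieties*, LNM 900
  (1982), Cor. 6.2 (notes by Milne)): for complex abelian varieties the Tate conjecture implies
  the Hodge conjecture — `TateImpliesHodgeAbelianStatement E B`, a `Prop`-valued definition
  quantifying the ACCEPTED `Literature.AlgebraicGeometry.Motives.TateConjecture` over all finitely generated subfields
  `k₀ ⊆ ℂ` and all primes `ℓ`.
* **hodge.S34** (Mumford 1966; Serre 1977; Moonen, *Families of motives and the Mumford–Tate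
  conjecture* (2017), §3): the Mumford–Tate conjecture `MumfordTateConjectureFor E B σ C hX hXσ i`
  and `MumfordTateConjecture E B σ C`: for `X` smooth projective over a number field `k`, the
  identity component of the Zariski closure of `ρ(Γ_k) ⊆ GL(Hⁱ_ét(X_{k̄}, ℚ_ℓ))` equals
  `MT(Hⁱ(X_σ(ℂ), ℚ)) ⊗ ℚ_ℓ` under Artin's comparison isomorphism.

## In-file helpers (hodge.S34)

* `Literature.Hodge.zariskiClosureEndOfBasis b S`, `Literature.Hodge.zariskiClosureEnd S` : the `K`-points of
  the Zariski closure of a subset `S ⊆ End_K(V)` (`V` finite-dimensional): the common zeros of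
  all polynomials in the matrix entries (w.r.t. a basis `b`, resp. `Module.Free.chooseBasis`)
  vanishing on `S`. `subset_zariskiClosureEnd`, `zariskiClosureEnd_mono`,
  `zariskiClosureEnd_basis_indep` (real: a change of basis is a polynomial substitution,
  `eval_bind₁_basisChange`).
* `Literature.hodgeTensorSpaceOver K W a b = W^{⊗a} ⊗ (W^∨)^{⊗b}` over any field `K` (G17's
  `hodgeTensorSpace V a b` is the case `K = ℚ`, by `rfl`), the action `tensorSpaceActOver g` of
  `g ∈ GL(W)`, the stabiliser subgroups `tensorStabilizerOver S`, and the comparison map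
  `tensorSpaceToBaseChange K V a b : T^{a,b} V →ₗ[ℚ] T^{a,b}_K (K ⊗ V)`.
* `HodgeStructure.mumfordTateGroupBaseChange K H ≤ GL(K ⊗_ℚ V)` : the `K`-points of the
  Mumford–Tate group, i.e. the automorphisms of `K ⊗ V` fixing (the base changes of) all
  weight-`0`, type-`(0,0)` Hodge tensors (extends G17 `HodgeStructure.mumfordTateGroup`, the
  case `K = ℚ`); `glBaseChange K : GL(V) →* GL(K ⊗ V)`; `mumfordTateGroup_le_comap`.

## Mathlib searches / design choices

* Mathlib has no Zariski closure of subsets of `End(V)`/`GL(V)` as a set of `K`-points, no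
  Mumford–Tate groups and no base change for `PiTensorProduct` (searched `zariskiClosure`,
  `MumfordTate`, `PiTensorProduct.*baseChange`: nothing). Used from Mathlib: `MvPolynomial.eval`,
  `LinearMap.toMatrix`, `Module.Free.chooseBasis`, `LinearEquiv.baseChange` (with
  `LinearEquiv.baseChange_one/_mul`), `Module.Dual.baseChange`, `TensorProduct.mapOfCompatibleSMul`
  (the canonical map `A ⊗_ℚ B → A ⊗_K B`), `PiTensorProduct.congr/lift`, `OpenSubgroup`,
  `NumberField`, `Algebra.EssFiniteType`.
* **Review 1 fix (hodge.S34).** The Zariski closure of `ρ(U)` is taken in the affine space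
  `End(V_ℓ)` and then intersected with the units: `{f ∈ zariskiClosureEnd (ρ '' U) | IsUnit f}`
  is the set of `ℚ_ℓ`-points of the Zariski closure of `ρ(U)` in `GL(V_ℓ)` (`GL = D(det)` is a
  basic open of `End`). Without `∩ IsUnit` the statement is false whenever `MT = GL(V)` (e.g.
  `H¹` of a non-CM elliptic curve, Serre 1972): the closure in `End` then contains non-invertible
  endomorphisms while the right-hand side consists of automorphisms.
* "Identity component" is avoided: by Serre (1977/1981; Moonen 2017, §3.1) the Zariski closure
  `G_ℓ(U)` of `ρ(U)` is independent of the open subgroup `U ≤ Γ_k` for `U` small enough and then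
  equals the identity component `G_ℓ°`; the statement is phrased as
  `∃ U₀, ∀ U ≤ U₀, closure(ρ(U)) ∩ GL = MT_{ℚ_ℓ}`.
* `mumfordTateGroupBaseChange K H` fixes the images `ι t ∈ T^{a,b}_K (K ⊗ V)` of the Hodge
  tensors `t` under the comparison map `ι = tensorSpaceToBaseChange` (equivalently, fixes
  pointwise the `K`-span of these images, i.e. the base change of the space of Hodge tensors).
  For polarizable `H` (as for `B.hodge`) this is `MT(H)(K)` (Deligne, LNM 900, I Prop. 3.4).
* **Instance hypotheses inherited from the accepted preludes.** `HodgeStructure.tensorSpace`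
  (hence `mumfordTateGroupBaseChange`, `mumfordTateGroup_le_comap`, `MumfordTateConjectureFor`)
  takes the `Prop`-valued class `[HodgeTensorFacts]` of `HodgeTensor` (Deligne, Hodge II,
  1.1.12, vendored as named facts); `chowGroupCycleMap` takes `[CompactSpace X.left]`
  (supplied for smooth projective `X` by the named fact `IsSmoothProjective.compactSpace`);
  `AbelianVariety.isSmoothProjective` is a named fact, so hodge.S20 quantifies over a proof
  `hA : IsSmoothProjective A.dim A.X`.
* hodge.S20 is a `def … : Prop` only: relative to *unrelated* hypothesis structures `E`, `B` the
  implication is not a theorem (Deligne's proof passes through absolute Hodge classes and the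
  comparison isomorphism); it becomes Deligne's Cor. 6.2 at the intended values.
* Namespaces: `Literature.Hodge` for statements; the dot-notation extension
  `Literature.AlgebraicGeometry.Motives.HodgeStructure.mumfordTateGroupBaseChange` is deliberately placed in `Literature.AlgebraicGeometry.Motives.HodgeStructure`
  next to G17's `mumfordTateGroup`.

## References

* P. Deligne, SGA 4½, [Cycle]; J. Tate, *Conjectures on algebraic cycles in ℓ-adic cohomology*,
  PSPM 55 (1994), §1; J. S. Milne, *Étale cohomology*, PUP 1980, VI.9.
* I. I. Piatetski-Shapiro, *Interrelations between the Tate and Hodge conjectures for abelian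
  varieties*, Mat. Sb. 85 (1971), 610–620.
* P. Deligne, *Hodge cycles on abelian varieties* (notes by J. S. Milne), in LNM 900 (1982),
  §2 (Thm. 2.11) and §6 (Cor. 6.2).
* D. Mumford, *Families of abelian varieties*, PSPM 9 (1966), §4.
* J.-P. Serre, *Représentations ℓ-adiques*, in Algebraic Number Theory (Kyoto 1976), JSPS 1977,
  §1; letters to Ribet (1981), Œuvres IV.
* B. Moonen, *Families of motives and the Mumford–Tate conjecture*, Milan J. Math. 85 (2017),
  §3.
-/

universe u v

open CategoryTheory AlgebraicGeometry
open scoped TensorProduct PiTensorProduct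

noncomputable section

namespace Literature.AlgebraicGeometry.Motives

section Hodge

/-! ### hodge.S26: ℓ-adic cohomology as a continuous Galois representation -/

section EtaleDefs

variable {k : Type u} [Field k] {ℓ : ℕ} [Fact ℓ.Prime] (E : EtaleRealization k ℓ)

/-- **hodge.S26** (definition of `Hⁱ(X_{k̄}, ℚ_ℓ)` as a continuous Galois representation;
SGA 4½ [Arcata] V, [Cycle]; Tate 1994 §1; Milne, *Étale cohomology* VI.9). The continuous
representation `E.galoisRep X i : Γ_k → GL(Hⁱ(X))` of the GalRep trunk acts through the
Galois action `E.ρ X i` of the realization (by `rfl`). [cite: Tate1994, §1] -/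
theorem galoisRep_apply' (X : SchemeOver k) (i : ℕ) (g : Field.absoluteGaloisGroup k)
    (v : E.V X i) : E.galoisRep X i g v = E.ρ X i g v :=
  rfl

/-- **hodge.S26** (definition of the Tate twist `Hⁱ(X_{k̄}, ℚ_ℓ(j))`; Tate 1994 §1; SGA 4½
[Cycle] 1.1). The twisted continuous representation acts by `g ↦ χ_ℓ(g)ʲ • ρ(g)`, where
`χ_ℓ = padicCyclotomicCharacter k ℓ` is the ℓ-adic cyclotomic character (by `rfl`). [cite: Tate1994, §1] -/
theorem galoisRepTwist_apply' (X : SchemeOver k) (i : ℕ) (j : ℤ)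
    (g : Field.absoluteGaloisGroup k) (v : E.V X i) :
    E.galoisRepTwist X i j g v =
      ((padicCyclotomicCharacter k ℓ g : ℚ_[ℓ]) ^ j) • E.ρ X i g v :=
  rfl

/-- **hodge.S26** (definition of the Tate classes; Tate 1994 §1). The space of Tate classes
`Tateᵖ(X) ⊆ H²ᵖ(X_{k̄}, ℚ_ℓ(p))` is the space of smooth invariants of the twisted representation
`H²ᵖ(X)(p)`: the classes fixed by some open subgroup of `Γ_k`, i.e. Galois invariant over a
finite extension of `k` (by `rfl`, G17 `GaloisWeilCohomology.tateClasses`). [cite: Tate1994, §1] -/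
theorem tateClasses_def (X : SchemeOver k) (p : ℕ) :
    E.tateClasses X p = smoothInvariants (E.ρTwist X (2 * p) p) :=
  rfl

/-- **hodge.S26** (the ℓ-adic cycle class map is `Γ_k`-equivariant; SGA 4½ [Cycle] 2.2;
Tate 1994 §1; Milne VI.9). For `X` smooth projective of dimension `n = p + d` over `k`, the
ℓ-adic cycle class map `CH_d(X) → H²ᵖ(X_{k̄}, ℚ_ℓ(p))` takes values in the `Γ_k`-invariants of
the twisted continuous representation `E.galoisRepTwist X (2p) p`. Real proof, from the accepted
`EtaleRealization.chowGroupCycleMap_mem_invariants_twist`; as there, compactness of `X` (needed by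
`WeilCohomology.chowGroupCycleMap`) is an instance hypothesis, supplied for smooth projective `X`
by the named fact `IsSmoothProjective.compactSpace`. [cite: Tate1994, §1] -/
theorem chowGroupCycleMap_mem_invariants_twist' {n : ℕ} {X : SchemeOver k}
    (hX : IsSmoothProjective n X) [CompactSpace X.left] {p d : ℕ} (h : p + d = n)
    (x : ChowGroup X.left d) (g : Field.absoluteGaloisGroup k) :
    E.galoisRepTwist X (2 * p) p g (E.chowGroupCycleMap hX h x : E.V X (2 * p)) =
      E.chowGroupCycleMap hX h x :=
  E.chowGroupCycleMap_mem_invariants_twist hX h x g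

/-- **hodge.S26** (pin of `Hⁱ(X)` to Mathlib's pro-étale ℓ-adic cohomology; Bhatt–Scholze 2015,
§5.6, Def. 6.8.1). `E` is a pro-étale model iff every `Hⁱ(X)` is isomorphic as a group to
`ℚ ⊗_ℤ Hⁱ_proét(X_{k̄}, ℤ_ℓ)` (`Scheme.EllAdicCohomology` of the base change to
`AlgebraicClosure k`). [cite: BhattScholze2015, §5.6  Def. 6.8.1] -/
theorem isProetaleModel_iff : E.IsProetaleModel ↔ ∀ (X : SchemeOver k) (i : ℕ),
    Nonempty (E.obj X i ≃+
      ℚ ⊗[ℤ] ((baseChange k (AlgebraicClosure k)).obj X).left.EllAdicCohomology ℓ i) :=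
  Iff.rfl

end EtaleDefs

/-! ### hodge.S20: Tate ⇒ Hodge for complex abelian varieties -/

/-- **hodge.S20** (Piatetski-Shapiro, Mat. Sb. 85 (1971); Deligne, *Hodge cycles on abelian
varieties*, LNM 900 (1982), Cor. 6.2, notes by Milne). *For complex abelian varieties the Tate
conjecture implies the Hodge conjecture.* Relative to a family of étale realizations
`E k₀ ℓ` (one for every subfield `k₀ ⊆ ℂ` and prime `ℓ`) and Betti–Hodge data `B` over `ℂ`:
if the ACCEPTED Tate conjecture `TateConjecture ℓ (E k₀ ℓ)` (algebraicity of Galois invariants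
and semisimplicity, `Literature.AlgebraicGeometry.Motives.TateConjecture`) holds for every finitely generated subfield
`k₀ ⊆ ℂ` (`Algebra.EssFiniteType ℤ k₀`; then `ℓ ≠ char k₀ = 0` automatically, supplied as the
`NeZero` instance the accepted statement demands) and every prime `ℓ`, then the Hodge
conjecture `B.HodgeConjectureFor` holds for every complex abelian variety `A` in every
codimension `p` (smooth projectivity of `A`, the named fact `AbelianVariety.isSmoothProjective`,
enters as the hypothesis `hA` that `B.HodgeConjectureFor` consumes). (Deligne's proof: Hodge
classes on abelian varieties are absolute Hodge, hence Tate classes over a finitely generated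
field of definition.) A `Prop`-valued definition: at unrelated hypothesis structures `E`, `B` it
is not a theorem; it is Deligne's Cor. 6.2 at the intended values (ℓ-adic and Betti
cohomology). [folklore] -/
def TateImpliesHodgeAbelianStatement
    (E : ∀ (k₀ : Subfield ℂ) (ℓ : ℕ) [Fact ℓ.Prime], EtaleRealization k₀ ℓ)
    (B : BettiHodgeData ℂ) : Prop :=
  (∀ (k₀ : Subfield ℂ) [Algebra.EssFiniteType ℤ k₀] (ℓ : ℕ) [Fact ℓ.Prime],
      haveI : NeZero ((ℓ : ℕ) : k₀) := ⟨Nat.cast_ne_zero.2 (Fact.out : ℓ.Prime).ne_zero⟩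
      TateConjecture ℓ (E k₀ ℓ).toGaloisWeilCohomology) →
    ∀ (A : AbelianVariety ℂ) (hA : IsSmoothProjective A.dim A.X) (p : ℕ), B.HodgeConjectureFor hA p

/-! ### hodge.S34, helper 1: Zariski closures in `End(V)` -/

section Zariski

variable {K : Type u} [Field K] {V : Type v} [AddCommGroup V] [Module K V]

/-- The `K`-points of the **Zariski closure** of `S ⊆ End_K(V)` computed in a basis `b` indexed
by a finite type `ι`: the endomorphisms `f` at whose matrix `(b.toMatrix f)ᵢⱼ` every polynomial
`P ∈ K[xᵢⱼ]` vanishing on the matrices of all `g ∈ S` vanishes (Borel, *Linear algebraic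
groups*, AG §1; Moonen 2017, §3.1). Independent of `b` (`zariskiClosureEnd_basis_indep`). [cite: Moonen2017, §3.1] -/
def zariskiClosureEndOfBasis {ι : Type*} [Fintype ι] [DecidableEq ι] (b : Module.Basis ι K V)
    (S : Set (Module.End K V)) : Set (Module.End K V) :=
  {f | ∀ P : MvPolynomial (ι × ι) K,
    (∀ g ∈ S, MvPolynomial.eval (fun ij ↦ LinearMap.toMatrix b b g ij.1 ij.2) P = 0) →
      MvPolynomial.eval (fun ij ↦ LinearMap.toMatrix b b f ij.1 ij.2) P = 0}

/-- Membership in `zariskiClosureEndOfBasis`. [folklore] -/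
theorem mem_zariskiClosureEndOfBasis_iff {ι : Type*} [Fintype ι] [DecidableEq ι]
    (b : Module.Basis ι K V) (S : Set (Module.End K V)) (f : Module.End K V) :
    f ∈ zariskiClosureEndOfBasis b S ↔ ∀ P : MvPolynomial (ι × ι) K,
      (∀ g ∈ S, MvPolynomial.eval (fun ij ↦ LinearMap.toMatrix b b g ij.1 ij.2) P = 0) →
        MvPolynomial.eval (fun ij ↦ LinearMap.toMatrix b b f ij.1 ij.2) P = 0 :=
  Iff.rfl

/-- `S` is contained in its Zariski closure (in any basis). [folklore] -/
theorem subset_zariskiClosureEndOfBasis {ι : Type*} [Fintype ι] [DecidableEq ι]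
    (b : Module.Basis ι K V) (S : Set (Module.End K V)) : S ⊆ zariskiClosureEndOfBasis b S :=
  fun _ hf _ hP ↦ hP _ hf

/-- The Zariski closure (in any basis) is monotone. [folklore] -/
theorem zariskiClosureEndOfBasis_mono {ι : Type*} [Fintype ι] [DecidableEq ι]
    (b : Module.Basis ι K V) {S T : Set (Module.End K V)} (h : S ⊆ T) :
    zariskiClosureEndOfBasis b S ⊆ zariskiClosureEndOfBasis b T :=
  fun _ hf P hP ↦ hf P fun g hg ↦ hP g (h hg)

/-- **Change of coordinates is polynomial.** Substituting the generic conjugate `A · X · B`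
(`A = b'.toMatrix b`, `B = b.toMatrix b'`, `X = (xₖₗ)` the generic matrix) into
`P ∈ K[x_{i'j'}]` and evaluating at the `b`-matrix of `g` equals evaluating `P` at the
`b'`-matrix of `g` (Mathlib `basis_toMatrix_mul_linearMap_toMatrix_mul_basis_toMatrix`:
`A · [g]_b · B = [g]_{b'}`; Borel, *Linear algebraic groups*, AG §1). [folklore] -/
theorem eval_bind₁_basisChange {ι ι' : Type*} [Fintype ι] [DecidableEq ι] [Fintype ι']
    [DecidableEq ι'] (b : Module.Basis ι K V) (b' : Module.Basis ι' K V)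
    (P : MvPolynomial (ι' × ι') K) (g : Module.End K V) :
    MvPolynomial.eval (fun ij : ι × ι ↦ LinearMap.toMatrix b b g ij.1 ij.2)
        (MvPolynomial.bind₁ (fun i'j' : ι' × ι' ↦ ∑ l : ι, (∑ k : ι,
          MvPolynomial.C (b'.toMatrix b i'j'.1 k) * MvPolynomial.X (k, l)) *
            MvPolynomial.C (b.toMatrix b' l i'j'.2)) P) =
      MvPolynomial.eval (fun ij : ι' × ι' ↦ LinearMap.toMatrix b' b' g ij.1 ij.2) P := by
  rw [MvPolynomial.eval, MvPolynomial.eval₂Hom_bind₁, ← MvPolynomial.eval, ← MvPolynomial.eval]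
  refine congrArg (fun c ↦ MvPolynomial.eval c P) (funext fun ij ↦ ?_)
  conv_rhs => rw [← basis_toMatrix_mul_linearMap_toMatrix_mul_basis_toMatrix b' b b' b g]
  simp only [map_sum, map_mul, MvPolynomial.eval_C, MvPolynomial.eval_X, Matrix.mul_apply]

/-- The Zariski closure computed in basis `b` is contained in the one computed in any other
basis `b'` (pull a `b'`-polynomial back along the polynomial change of coordinates
`eval_bind₁_basisChange`). [folklore] -/
theorem zariskiClosureEndOfBasis_subset_of_basis {ι ι' : Type*} [Fintype ι] [DecidableEq ι]
    [Fintype ι'] [DecidableEq ι'] (b : Module.Basis ι K V) (b' : Module.Basis ι' K V)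
    (S : Set (Module.End K V)) :
    zariskiClosureEndOfBasis b S ⊆ zariskiClosureEndOfBasis b' S := by
  intro f hf P hP
  rw [← eval_bind₁_basisChange b b' P f]
  refine hf _ fun g hg ↦ ?_
  rw [eval_bind₁_basisChange b b' P g]
  exact hP g hg

/-- **Independence of the basis**: the `K`-points of the Zariski closure of `S ⊆ End_K(V)` do
not depend on the basis used to define them (Borel, *Linear algebraic groups*, AG §1). [folklore] -/
theorem zariskiClosureEndOfBasis_eq_of_basis {ι ι' : Type*} [Fintype ι] [DecidableEq ι]
    [Fintype ι'] [DecidableEq ι'] (b : Module.Basis ι K V) (b' : Module.Basis ι' K V)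
    (S : Set (Module.End K V)) :
    zariskiClosureEndOfBasis b S = zariskiClosureEndOfBasis b' S :=
  (zariskiClosureEndOfBasis_subset_of_basis b b' S).antisymm
    (zariskiClosureEndOfBasis_subset_of_basis b' b S)

variable [Module.Finite K V]

open scoped Classical in
/-- The `K`-points of the **Zariski closure** of a subset `S ⊆ End_K(V)` of the affine space of
endomorphisms of a finite-dimensional `K`-vector space: common zeros of all polynomials in the
matrix entries (w.r.t. `Module.Free.chooseBasis K V`) vanishing on `S` (Borel, AG §1; Moonen
2017, §3.1). See `zariskiClosureEnd_basis_indep` for independence of the basis. [folklore] -/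
def zariskiClosureEnd (S : Set (Module.End K V)) : Set (Module.End K V) :=
  zariskiClosureEndOfBasis (Module.Free.chooseBasis K V) S

/-- `S ⊆ S̄` (Zariski closure). [folklore] -/
theorem subset_zariskiClosureEnd (S : Set (Module.End K V)) : S ⊆ zariskiClosureEnd S := by
  classical
  exact subset_zariskiClosureEndOfBasis _ S

/-- The Zariski closure is monotone: `S ⊆ T → S̄ ⊆ T̄`. [folklore] -/
theorem zariskiClosureEnd_mono {S T : Set (Module.End K V)} (h : S ⊆ T) :
    zariskiClosureEnd S ⊆ zariskiClosureEnd T := by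
  classical
  exact zariskiClosureEndOfBasis_mono _ h

/-- The Zariski closure does not depend on the basis: a change of basis `f ↦ Q f Q⁻¹` is a
polynomial substitution in the matrix entries (Borel, *Linear algebraic groups*, AG §1). Real
proof (`zariskiClosureEndOfBasis_eq_of_basis`). [folklore] -/
theorem zariskiClosureEnd_basis_indep {ι : Type*} [Fintype ι] [DecidableEq ι]
    (b : Module.Basis ι K V) (S : Set (Module.End K V)) :
    zariskiClosureEndOfBasis b S = zariskiClosureEnd S := by
  classical
  exact zariskiClosureEndOfBasis_eq_of_basis b (Module.Free.chooseBasis K V) S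

/-- Invertible elements of `S` are `K`-points of the Zariski closure of `S` in `GL(V)`, i.e.
units lying in the closure `S̄ ⊆ End(V)`: `g ∈ S`, `g` invertible ⇒ `g ∈ S̄ ∧ IsUnit g`. [folklore] -/
theorem mem_zariskiClosureEnd_and_isUnit {S : Set (Module.End K V)} {g : Module.End K V}
    (hg : g ∈ S) (hu : IsUnit g) : g ∈ zariskiClosureEnd S ∧ IsUnit g :=
  ⟨subset_zariskiClosureEnd S hg, hu⟩

end Zariski

end Hodge

/-! ### hodge.S34, helper 2: tensor spaces over a field `K` and `MT(H)(K)` -/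

section TensorOver

variable (K : Type u) [Field K] (W : Type v) [AddCommGroup W] [Module K W]

/-- The tensor space `T^{a,b}_K W := W^{⊗a} ⊗_K (W^∨)^{⊗b}` over a field `K` (Deligne, LNM 900,
I §3.1). For `K = ℚ` this is G17's `hodgeTensorSpace W a b`, definitionally
(`hodgeTensorSpaceOver_rat`). [folklore] -/
abbrev hodgeTensorSpaceOver (a b : ℕ) : Type (max u v) :=
  (⨂[K]^a W) ⊗[K] (⨂[K]^b (Module.Dual K W))

variable {K W}

/-- G17's `hodgeTensorSpace V a b` is `hodgeTensorSpaceOver ℚ V a b` (by `rfl`). [folklore] -/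
theorem hodgeTensorSpaceOver_rat (V : Type v) [AddCommGroup V] [Module ℚ V] (a b : ℕ) :
    hodgeTensorSpaceOver ℚ V a b = hodgeTensorSpace V a b :=
  rfl

/-- The natural action of `g ∈ GL(W)` on `T^{a,b}_K W`: `g^{⊗a} ⊗ ((g⁻¹)^∨)^{⊗b}` (Deligne,
LNM 900, I §3.1); G17's `tensorSpaceAct` is the case `K = ℚ` (`tensorSpaceActOver_rat`). [folklore] -/
def tensorSpaceActOver {a b : ℕ} (g : W ≃ₗ[K] W) :
    hodgeTensorSpaceOver K W a b ≃ₗ[K] hodgeTensorSpaceOver K W a b :=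
  TensorProduct.congr (PiTensorProduct.congr fun _ ↦ g)
    (PiTensorProduct.congr fun _ ↦ g.symm.dualMap)

/-- G17's `tensorSpaceAct g` is `tensorSpaceActOver g` for `K = ℚ` (by `rfl`). [folklore] -/
theorem tensorSpaceActOver_rat {V : Type v} [AddCommGroup V] [Module ℚ V] {a b : ℕ}
    (g : V ≃ₗ[ℚ] V) : tensorSpaceActOver (a := a) (b := b) g = tensorSpaceAct g :=
  rfl

/-- `tensorSpaceActOver g` on pure tensors. [folklore] -/
@[simp]
theorem tensorSpaceActOver_tmul_tprod {a b : ℕ} (g : W ≃ₗ[K] W) (w : Fin a → W)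
    (φ : Fin b → Module.Dual K W) :
    tensorSpaceActOver g (PiTensorProduct.tprod K w ⊗ₜ[K] PiTensorProduct.tprod K φ) =
      (PiTensorProduct.tprod K fun i ↦ g (w i)) ⊗ₜ[K]
        PiTensorProduct.tprod K fun i ↦ (φ i).comp (g.symm : W →ₗ[K] W) := by
  simp [tensorSpaceActOver]
  rfl

/-- `tensorSpaceActOver g` as a linear map. [folklore] -/
theorem coe_tensorSpaceActOver {a b : ℕ} (g : W ≃ₗ[K] W) :
    (tensorSpaceActOver (a := a) (b := b) g :
        hodgeTensorSpaceOver K W a b →ₗ[K] hodgeTensorSpaceOver K W a b) =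
      TensorProduct.map (PiTensorProduct.map fun _ ↦ (g : W →ₗ[K] W))
        (PiTensorProduct.map fun _ ↦ (g.symm.dualMap : Module.Dual K W →ₗ[K] _)) :=
  rfl

/-- The identity acts trivially on `T^{a,b}_K W`. [folklore] -/
@[simp]
theorem tensorSpaceActOver_one {a b : ℕ} :
    tensorSpaceActOver (a := a) (b := b) (1 : W ≃ₗ[K] W) = 1 := by
  apply LinearEquiv.toLinearMap_injective
  rw [coe_tensorSpaceActOver]
  have h₁ : ((1 : W ≃ₗ[K] W) : W →ₗ[K] W) = LinearMap.id := rfl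
  have h₂ : ((1 : W ≃ₗ[K] W).symm.dualMap : Module.Dual K W →ₗ[K] Module.Dual K W) =
      LinearMap.id := rfl
  simp only [h₁, h₂, PiTensorProduct.map_id, TensorProduct.map_id]
  rfl

/-- The action on `T^{a,b}_K W` is multiplicative. [folklore] -/
theorem tensorSpaceActOver_mul {a b : ℕ} (g h : W ≃ₗ[K] W) :
    tensorSpaceActOver (a := a) (b := b) (g * h) =
      tensorSpaceActOver g * tensorSpaceActOver h := by
  apply LinearEquiv.toLinearMap_injective
  rw [LinearEquiv.mul_eq_trans, LinearEquiv.mul_eq_trans, LinearEquiv.coe_trans,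
    coe_tensorSpaceActOver, coe_tensorSpaceActOver, coe_tensorSpaceActOver,
    ← TensorProduct.map_comp, ← PiTensorProduct.map_comp, ← PiTensorProduct.map_comp]
  rfl

/-- `tensorSpaceActOver (g * h) t = tensorSpaceActOver g (tensorSpaceActOver h t)`. [folklore] -/
theorem tensorSpaceActOver_mul_apply {a b : ℕ} (g h : W ≃ₗ[K] W)
    (t : hodgeTensorSpaceOver K W a b) :
    tensorSpaceActOver (g * h) t = tensorSpaceActOver g (tensorSpaceActOver h t) := by
  rw [tensorSpaceActOver_mul]; rfl

/-- The subgroup of `GL(W)` fixing a family of tensors `S a b ⊆ T^{a,b}_K W` (over any field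
`K`; G17's `HodgeStructure.tensorStabilizer` is the case `K = ℚ`). [folklore] -/
def tensorStabilizerOver (S : ∀ a b : ℕ, Set (hodgeTensorSpaceOver K W a b)) :
    Subgroup (W ≃ₗ[K] W) where
  carrier := {g | ∀ a b, ∀ t ∈ S a b, tensorSpaceActOver g t = t}
  one_mem' a b t _ := by simp
  mul_mem' {g h} hg hh a b t ht := by
    rw [tensorSpaceActOver_mul_apply, hh a b t ht, hg a b t ht]
  inv_mem' {g} hg a b t ht := by
    apply (tensorSpaceActOver (a := a) (b := b) g).injective
    rw [← tensorSpaceActOver_mul_apply, mul_inv_cancel, tensorSpaceActOver_one, hg a b t ht]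
    rfl

/-- Membership in `tensorStabilizerOver`. [folklore] -/
theorem mem_tensorStabilizerOver_iff (S : ∀ a b : ℕ, Set (hodgeTensorSpaceOver K W a b))
    (g : W ≃ₗ[K] W) :
    g ∈ tensorStabilizerOver S ↔ ∀ a b, ∀ t ∈ S a b, tensorSpaceActOver g t = t :=
  Iff.rfl

end TensorOver

section BaseChangeTensors

variable (K : Type u) [Field K] [Algebra ℚ K] (V : Type v) [AddCommGroup V] [Module ℚ V]

/-- The comparison map `V^{⊗a} → (K ⊗ V)^{⊗a}_K`, `⊗ vᵢ ↦ ⊗ (1 ⊗ vᵢ)` (`ℚ`-linear), from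
`PiTensorProduct.lift` (Mathlib has no base change of `PiTensorProduct`). [folklore] -/
def piTensorToBaseChange (a : ℕ) : (⨂[ℚ]^a V) →ₗ[ℚ] ⨂[K]^a (K ⊗[ℚ] V) :=
  PiTensorProduct.lift
    (((PiTensorProduct.tprod K (s := fun _ : Fin a ↦ K ⊗[ℚ] V)).restrictScalars ℚ).compLinearMap
      fun _ ↦ TensorProduct.mk ℚ K V 1)

/-- `piTensorToBaseChange` on pure tensors. [folklore] -/
@[simp]
theorem piTensorToBaseChange_tprod {a : ℕ} (v : Fin a → V) :
    piTensorToBaseChange K V a (PiTensorProduct.tprod ℚ v) =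
      PiTensorProduct.tprod K fun i ↦ (1 : K) ⊗ₜ[ℚ] v i := by
  simp [piTensorToBaseChange]

/-- The comparison map `(V^∨)^{⊗b} → ((K ⊗ V)^∨)^{⊗b}_K`, `⊗ φᵢ ↦ ⊗ (φᵢ)_K` (`ℚ`-linear), with
`(φ)_K = Module.Dual.baseChange K φ`. [folklore] -/
def piTensorDualToBaseChange (b : ℕ) :
    (⨂[ℚ]^b (Module.Dual ℚ V)) →ₗ[ℚ] ⨂[K]^b (Module.Dual K (K ⊗[ℚ] V)) :=
  PiTensorProduct.lift
    (((PiTensorProduct.tprod K (s := fun _ : Fin b ↦ Module.Dual K (K ⊗[ℚ] V))).restrictScalars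
        ℚ).compLinearMap fun _ ↦ Module.Dual.baseChange K)

/-- `piTensorDualToBaseChange` on pure tensors. [folklore] -/
@[simp]
theorem piTensorDualToBaseChange_tprod {b : ℕ} (φ : Fin b → Module.Dual ℚ V) :
    piTensorDualToBaseChange K V b (PiTensorProduct.tprod ℚ φ) =
      PiTensorProduct.tprod K fun i ↦ Module.Dual.baseChange K (φ i) := by
  simp [piTensorDualToBaseChange]

/-- The **comparison map** `ι : T^{a,b} V → T^{a,b}_K (K ⊗_ℚ V)`,
`(⊗ vᵢ) ⊗ (⊗ φⱼ) ↦ (⊗ (1 ⊗ vᵢ)) ⊗ (⊗ (φⱼ)_K)` (`ℚ`-linear; an isomorphism onto a `ℚ`-form for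
`V` finite-dimensional). Built from `piTensorToBaseChange`, `piTensorDualToBaseChange` and
Mathlib's canonical map `TensorProduct.mapOfCompatibleSMul : A ⊗_ℚ B → A ⊗_K B`. [folklore] -/
def tensorSpaceToBaseChange (a b : ℕ) :
    hodgeTensorSpace V a b →ₗ[ℚ] hodgeTensorSpaceOver K (K ⊗[ℚ] V) a b :=
  TensorProduct.mapOfCompatibleSMul K ℚ ℚ (⨂[K]^a (K ⊗[ℚ] V))
      (⨂[K]^b (Module.Dual K (K ⊗[ℚ] V))) ∘ₗ
    TensorProduct.map (piTensorToBaseChange K V a) (piTensorDualToBaseChange K V b)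

/-- `tensorSpaceToBaseChange` on pure tensors. [folklore] -/
@[simp]
theorem tensorSpaceToBaseChange_tprod_tmul_tprod {a b : ℕ} (v : Fin a → V)
    (φ : Fin b → Module.Dual ℚ V) :
    tensorSpaceToBaseChange K V a b (PiTensorProduct.tprod ℚ v ⊗ₜ[ℚ] PiTensorProduct.tprod ℚ φ) =
      (PiTensorProduct.tprod K fun i ↦ (1 : K) ⊗ₜ[ℚ] v i) ⊗ₜ[K]
        PiTensorProduct.tprod K fun i ↦ Module.Dual.baseChange K (φ i) := by
  simp [tensorSpaceToBaseChange]

/-- Base change of automorphisms as a group homomorphism `GL(V) →* GL(K ⊗_ℚ V)`,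
`g ↦ 1 ⊗ g` (Mathlib `LinearEquiv.baseChange`, `LinearEquiv.baseChange_one/_mul`). [folklore] -/
def glBaseChange : (V ≃ₗ[ℚ] V) →* ((K ⊗[ℚ] V) ≃ₗ[K] (K ⊗[ℚ] V)) where
  toFun g := g.baseChange ℚ K V V
  map_one' := LinearEquiv.baseChange_one ℚ K V
  map_mul' := LinearEquiv.baseChange_mul ℚ K V

/-- `glBaseChange K V g = g.baseChange K`. [folklore] -/
@[simp]
theorem glBaseChange_apply (g : V ≃ₗ[ℚ] V) : glBaseChange K V g = g.baseChange ℚ K V V := rfl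

/-- **Naturality of the comparison map**: `ι (g · t) = (1 ⊗ g) · ι t` for `g ∈ GL(V)` and
`t ∈ T^{a,b} V` (Deligne, LNM 900, I §3.1: the action on tensor spaces commutes with extension
of scalars). [folklore] -/
theorem tensorSpaceToBaseChange_tensorSpaceAct {a b : ℕ} (g : V ≃ₗ[ℚ] V)
    (t : hodgeTensorSpace V a b) :
    tensorSpaceToBaseChange K V a b (tensorSpaceAct g t) =
      tensorSpaceActOver (g.baseChange ℚ K V V) (tensorSpaceToBaseChange K V a b t) := by
  have hdual : ∀ φ : Module.Dual ℚ V,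
      Module.Dual.baseChange K (φ ∘ₗ (g.symm : V →ₗ[ℚ] V)) =
        (Module.Dual.baseChange K φ) ∘ₗ
          ((g.baseChange ℚ K V V).symm : K ⊗[ℚ] V →ₗ[K] K ⊗[ℚ] V) := by
    intro φ
    ext v
    simp
  suffices h : tensorSpaceToBaseChange K V a b ∘ₗ
        (tensorSpaceAct (a := a) (b := b) g).toLinearMap =
      ((tensorSpaceActOver (a := a) (b := b) (g.baseChange ℚ K V V)).toLinearMap.restrictScalars
          ℚ) ∘ₗ tensorSpaceToBaseChange K V a b from
    LinearMap.congr_fun h t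
  ext v φ
  simp [hdual]

end BaseChangeTensors

namespace HodgeStructure

variable (K : Type u) [Field K] [Algebra ℚ K] {V : Type v} [AddCommGroup V] [Module ℚ V]
  [HodgeTensorFacts.{v, v}] [Module.Finite ℚ V] {n : ℤ}

/-- The **`K`-points of the Mumford–Tate group** `MT(H)(K) ≤ GL(K ⊗_ℚ V)` of a Hodge structure
`H` on a finite-dimensional `V`: the `K`-linear automorphisms of `K ⊗ V` fixing the base change
`ι t` of every rational tensor `t ∈ T^{a,b} V` of weight `0` (`(a - b) n = 0`) and type `(0,0)`
(Deligne, LNM 900, I Prop. 3.4; Moonen, *An introduction to Mumford–Tate groups*, §4). Extends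
G17's `mumfordTateGroup` (`K = ℚ`; `mumfordTateGroup_le_comap`). For polarizable `H` this is
the group of `K`-points of the Mumford–Tate group; in general it contains it. Deliberate
dot-notation extension of the accepted `Literature.AlgebraicGeometry.Motives.HodgeStructure` namespace. [folklore] -/
def mumfordTateGroupBaseChange (H : HodgeStructure V n) :
    Subgroup ((K ⊗[ℚ] V) ≃ₗ[K] (K ⊗[ℚ] V)) :=
  tensorStabilizerOver fun a b ↦ tensorSpaceToBaseChange K V a b ''
    {t | ((a : ℤ) - b) * n = 0 ∧ t ∈ (H.tensorSpace a b).hodgeClasses 0}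

/-- Membership in `MT(H)(K)`: `γ` fixes `ι t` for every weight-`0`, type-`(0,0)` Hodge tensor
`t`. [folklore] -/
theorem mem_mumfordTateGroupBaseChange_iff (H : HodgeStructure V n)
    (γ : (K ⊗[ℚ] V) ≃ₗ[K] (K ⊗[ℚ] V)) :
    γ ∈ H.mumfordTateGroupBaseChange K ↔ ∀ a b : ℕ, ((a : ℤ) - b) * n = 0 →
      ∀ t ∈ (H.tensorSpace a b).hodgeClasses 0,
        tensorSpaceActOver γ (tensorSpaceToBaseChange K V a b t) =
          tensorSpaceToBaseChange K V a b t := by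
  refine ⟨fun hγ a b hab t ht ↦ hγ a b _ ⟨t, ⟨hab, ht⟩, rfl⟩, fun hγ a b s hs ↦ ?_⟩
  obtain ⟨t, ⟨hab, ht⟩, rfl⟩ := hs
  exact hγ a b hab t ht

end HodgeStructure

section Hodge

/-- `MT(H)(ℚ) ⊆ MT(H)(K)`: the base change `1 ⊗ g` of `g ∈ MT(H)` fixes the base-changed Hodge
tensors (naturality `tensorSpaceToBaseChange_tensorSpaceAct`; Deligne, LNM 900, I §3.1). [folklore] -/
theorem mumfordTateGroup_le_comap (K : Type u) [Field K] [Algebra ℚ K] {V : Type v}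
    [AddCommGroup V] [Module ℚ V] [HodgeTensorFacts.{v, v}] [Module.Finite ℚ V] {n : ℤ}
    (H : HodgeStructure V n) :
    H.mumfordTateGroup ≤ (H.mumfordTateGroupBaseChange K).comap (glBaseChange K V) := by
  intro g hg
  rw [Subgroup.mem_comap, glBaseChange_apply, HodgeStructure.mem_mumfordTateGroupBaseChange_iff]
  intro a b hab t ht
  rw [← tensorSpaceToBaseChange_tensorSpaceAct,
    (H.mem_mumfordTateGroup_iff g).1 hg a b hab t ht]

/-! ### hodge.S34: the Mumford–Tate conjecture -/

section MumfordTate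

variable {k : Type} [Field k] {ℓ : ℕ} [Fact ℓ.Prime]
  (E : EtaleRealization k ℓ) (B : BettiHodgeData ℂ) (σ : k →+* ℂ) (C : ArtinComparison E B σ)

/-- The comparison isomorphism `ℚ_ℓ ⊗_ℚ Hⁱ_B(X_σ(ℂ), ℚ) ≃ₗ[ℚ_ℓ] Hⁱ_ét(X_{k̄}, ℚ_ℓ)` for `X` smooth
projective, extracted from Artin comparison data `C` (SGA 4 XI 4.4):
`(C.isoEquiv hX i).symm` followed by `ℚ_ℓ ⊗_{ℚ_ℓ} H ≃ H` (`TensorProduct.lid`). [folklore] -/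
def artinComparisonEquiv {n : ℕ} {X : SchemeOver k} (hX : IsSmoothProjective n X) (i : ℕ) :
    ℚ_[ℓ] ⊗[ℚ] B.W.obj ((baseChangeHom σ).obj X) i ≃ₗ[ℚ_[ℓ]] E.obj X i :=
  (C.isoEquiv hX i).symm ≪≫ₗ TensorProduct.lid ℚ_[ℓ] (E.obj X i)

/-- Unfolding of `artinComparisonEquiv`: it is `lid ∘ C.isoInv`. [folklore] -/
theorem artinComparisonEquiv_apply {n : ℕ} {X : SchemeOver k} (hX : IsSmoothProjective n X)
    (i : ℕ) (x : ℚ_[ℓ] ⊗[ℚ] B.W.obj ((baseChangeHom σ).obj X) i) :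
    artinComparisonEquiv E B σ C hX i x = TensorProduct.lid ℚ_[ℓ] (E.obj X i) (C.isoInv X i x) :=
  rfl

/-- **hodge.S34** (the Mumford–Tate conjecture for `Hⁱ(X)`; Mumford, PSPM 9 (1966), §4; Serre,
*Représentations ℓ-adiques* (1977), §1 and letters to Ribet (1981); Moonen, *Families of motives
and the Mumford–Tate conjecture* (2017), §3, Conj. 3.2). Let `k` be a number field,
`σ : k →+* ℂ`, `X/k` smooth projective with `X_σ/ℂ` smooth projective, `E` the ℓ-adic
realization with Galois representation `ρ = E.ρ X i : Γ_k → GL(Hⁱ_ét(X_{k̄}, ℚ_ℓ))`, `B` the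
Betti–Hodge realization and `C` Artin comparison data, giving
`e : ℚ_ℓ ⊗ Hⁱ_B(X_σ, ℚ) ≃ Hⁱ_ét(X_{k̄}, ℚ_ℓ)` (`artinComparisonEquiv`). **Statement:** there is
an open subgroup `U₀ ≤ Γ_k` such that for every open subgroup `U ≤ U₀`, the `ℚ_ℓ`-points of the
Zariski closure of `ρ(U)` in `GL(Hⁱ_ét)` — computed as the units in the Zariski closure
`zariskiClosureEnd (ρ '' U)` inside the affine space `End(Hⁱ_ét)` — coincide with the transport
along `e` of `MT(Hⁱ_B(X_σ, ℚ))(ℚ_ℓ)` (`HodgeStructure.mumfordTateGroupBaseChange ℚ_[ℓ]` of the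
Hodge structure `B.hodge hXσ i`). By Serre, the closure `G_ℓ(U)` is independent of `U` small
enough and is then the identity component `G_ℓ°`, so this says `G_ℓ° = MT ⊗ ℚ_ℓ`.
**Why `∩ IsUnit` (review 1):** the closure of `ρ(U)` in `End` strictly contains its closure in
`GL` whenever the latter is not closed in `End`, e.g. when `MT = GL(V)` (`H¹` of a non-CM
elliptic curve, Serre 1972), where the closure in `End` is all of `End(V)`; intersecting with
the units gives exactly the `ℚ_ℓ`-points of the closure in `GL = D(det) ⊆ End`.
A `Prop`-valued definition (open in general; known e.g. for abelian varieties of dimension `≤ 3`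
and for K3 surfaces). [cite: Serre1972] -/
@[nolint unusedArguments] -- `[NumberField k]` is a deliberate hypothesis of the conjecture
-- (it is stated for finitely generated `k`; number fields per the inventory), not used in the body.
def MumfordTateConjectureFor [NumberField k] [HodgeTensorFacts.{0, 0}] ⦃n : ℕ⦄ ⦃X : SchemeOver k⦄
    (hX : IsSmoothProjective n X)
    (hXσ : IsSmoothProjective n ((baseChangeHom σ).obj X)) (i : ℕ) : Prop :=
  haveI : Module.Finite ℚ (B.W.obj ((baseChangeHom σ).obj X) i) := B.W.finite_obj hXσ i
  haveI : Module.Finite ℚ_[ℓ] (E.obj X i) := E.finite_obj hX i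
  let e : ℚ_[ℓ] ⊗[ℚ] B.W.obj ((baseChangeHom σ).obj X) i ≃ₗ[ℚ_[ℓ]] E.obj X i :=
    artinComparisonEquiv E B σ C hX i
  ∃ U₀ : OpenSubgroup (Field.absoluteGaloisGroup k),
    ∀ U : OpenSubgroup (Field.absoluteGaloisGroup k), U ≤ U₀ →
      {f : Module.End ℚ_[ℓ] (E.obj X i) |
          f ∈ zariskiClosureEnd
              ((fun g ↦ (E.ρ X i g : Module.End ℚ_[ℓ] (E.obj X i))) ''
                (U : Set (Field.absoluteGaloisGroup k))) ∧
            IsUnit f} =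
        (fun γ ↦ ((e.symm ≪≫ₗ γ ≪≫ₗ e : E.obj X i ≃ₗ[ℚ_[ℓ]] E.obj X i) :
            Module.End ℚ_[ℓ] (E.obj X i))) ''
          ((B.hodge hXσ i).mumfordTateGroupBaseChange ℚ_[ℓ] :
            Set ((ℚ_[ℓ] ⊗[ℚ] B.W.obj ((baseChangeHom σ).obj X) i) ≃ₗ[ℚ_[ℓ]]
              (ℚ_[ℓ] ⊗[ℚ] B.W.obj ((baseChangeHom σ).obj X) i)))

/-- **hodge.S34** (the Mumford–Tate conjecture; Mumford 1966; Serre 1977; Moonen 2017, §3,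
Conj. 3.2). For every smooth projective `X` over the number field `k` (with `X_σ` smooth
projective over `ℂ`) and every degree `i`, `MumfordTateConjectureFor E B σ C hX hXσ i`: the
identity component of the Zariski closure of the image of Galois in `GL(Hⁱ_ét(X_{k̄}, ℚ_ℓ))`
equals `MT(Hⁱ(X_σ(ℂ), ℚ)) ⊗ ℚ_ℓ` under Artin's comparison isomorphism. A `Prop`-valued
definition (open problem). [cite: Mumford1966] -/
def MumfordTateConjecture [NumberField k] [HodgeTensorFacts.{0, 0}] : Prop :=
  ∀ ⦃n : ℕ⦄ ⦃X : SchemeOver k⦄ (hX : IsSmoothProjective n X)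
    (hXσ : IsSmoothProjective n ((baseChangeHom σ).obj X)) (i : ℕ),
    MumfordTateConjectureFor E B σ C hX hXσ i

/-- Sanity: the images `ρ(g)`, `g ∈ U`, are `ℚ_ℓ`-points of the Zariski closure of `ρ(U)` in
`GL`, i.e. lie in the left-hand side of `MumfordTateConjectureFor` (they are units of `End`
lying in `ρ(U) ⊆ closure`). [folklore] -/
theorem ρ_mem_zariskiClosureEnd_and_isUnit {n : ℕ} {X : SchemeOver k}
    (hX : IsSmoothProjective n X) (i : ℕ) (U : OpenSubgroup (Field.absoluteGaloisGroup k))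
    {g : Field.absoluteGaloisGroup k} (hg : g ∈ U) :
    haveI : Module.Finite ℚ_[ℓ] (E.obj X i) := E.finite_obj hX i
    (E.ρ X i g : Module.End ℚ_[ℓ] (E.obj X i)) ∈
        zariskiClosureEnd ((fun g ↦ (E.ρ X i g : Module.End ℚ_[ℓ] (E.obj X i))) ''
          (U : Set (Field.absoluteGaloisGroup k))) ∧
      IsUnit (E.ρ X i g : Module.End ℚ_[ℓ] (E.obj X i)) :=
  haveI : Module.Finite ℚ_[ℓ] (E.obj X i) := E.finite_obj hX i
  mem_zariskiClosureEnd_and_isUnit ⟨g, hg, rfl⟩ ((Group.isUnit g).map (E.ρ X i))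

end MumfordTate

end Hodge

end Literature.AlgebraicGeometry.Motives

end
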